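import Summits.QuantumFields.YangMills.Theorems.UnitScaleTiltFluctuationComparisonRegPrTwoCutoffTowerLimit
import Summits.QuantumFields.YangMills.Theorems.UnitScaleTiltFluctuationComparisonRegPrGlobalSlackKernelLegWeights
import Summits.QuantumFields.YangMills.Theorems.UnitScaleTiltFluctuationComparisonRegPrGlobalSlackCanonicalPolymersTermSize
import Summits.QuantumFields.YangMills.Theorems.UnitScaleTiltFluctuationComparisonRegPrGlobalSlackKernelLegResidualSplitV4
import Summits.QuantumFields.YangMills.Theorems.UnitScaleTiltFluctuationComparisonRegPrGlobalSlackLegCfgDistNaturalRows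
import HarnessLib

/-!
# `UnitScaleTiltFluctuationComparisonRegPrGlobalSlackLegOldTermsKernelForm` — PRINT'S (43) «THE OLD TERMS ARE POLYNOMIALS OF DEGREE 2…6 IN THE LOOP VARIABLES WITH FIELD-INDEPENDENT,
# LEG-INDEXED KERNELS» AS THE SUPPLIER OF THE OLD-LEVEL CHARTS: the leg-indexed kernel polynomial `P_N(x) = Σ_{n∈[2,7)} (n!)⁻¹ Σ_c N_n(c)(x(c₁),…,x(c_n))`, its jet identity
# `jet26 P_N = P_N`, its (R2′) clause from a leg-weighted kernel-size budget, and the natural chart family `Φ♮[Φ₀, N]` (kernel polynomials on the old blocks, a background family `Φ₀`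
# elsewhere) with its evaluation lemmas — generic in the chart-value space `𝕍` (crux `FluctuationComparisonRegPrIntL`, stmt-QuantumFields-20520, STUB 3⁗χ(v4); cell `pub/ym-inputs`,
# seat ym-inputs-p11 (g2); count-neutral helper, def-free, registry untouched)

WHY.  In the door display `K1aLegRowsDisplayChiAtLow(V4)` the chart family `Φ` is an EXISTENTIAL constrained on the new level by (N) (`Φ K k (domSet X) = birthChartRows q K k (domSet X)`)
and on the old blocks only through (M1) `OldTermsAreJetsOwn(Rows) q Φ e B`: «`oldTerm q K k (1+j) y W = e K j (blockSet y) + Re jet26 (Φ K j (blockSet y)) (B K (k+1) j (blockSet y) W)`»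
— the record's previous-scale terms ARE the order-2…6 jets of SOME chart at the configuration family.  Print says what that chart is, (43) p.266: «Y_j = (y, c₁, …, c_n) …
𝒫_j(Y_j, U_k) = ⟨𝒫_j(Y_j), B_k(c₁), …, B_k(c_n)⟩, n ≥ 2» («at most the sixth order», p.264 L18–20) — for each block `y`, degree `n` and LEG TUPLE `c = (c₁,…,c_n)` an `n`-linear
kernel applied to the loop variables of the legs, the kernels born at step `j` and independent of the field.  So at an old block the natural chart is the LEG-INDEXED KERNEL POLYNOMIAL
`P_N(x) := Σ_{n∈[2,7)} (n!)⁻¹ Σ_{c : Fin n → bonds} N_n(c)(x(c₁), …, x(c_n))` of a kernel family `N`, and (M1) for it is EXACTLY the statement that the record's old terms have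
print's form (43) at the natural loop variables `B♮ᴿ` of `…LegCfgDistNaturalRows`.  This file supplies the record-free half, GENERIC in the chart-value space `𝕍` and the bond
index type (the instance is `𝕍 := 𝔤ᶜ = ↥(lieC (suGroupModel 2))`, `ι := PBond (F.P K) b`; LOCATED: the generic polynomial-chart lemmas of ✓p623011 `…TwoCutoffTowerLimit` do not
instantiate at a kernel family typed over the concrete Pi chart space `PBond (F.P K) b → 𝔤ᶜ` — `differentiable_polyChart _` diverges there at 2·10⁶ heartbeats — but instantiate
instantly at `𝔤ᶜ`-level multilinear kernels; hence the leg-indexed typing, which is also print's):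

* §1 ★ **`jet26_polyChart`** — for ANY diagonal kernel family `M` (no symmetry asked) the kernel polynomial `x ↦ Σ_{n∈[2,7)} (n!)⁻¹·M_n(x,…,x)` is its own order-2…6 jet at `0`
  (Mathlib `HasFPowerSeriesOnBall.factorial_smul` on ✓`hasFiniteFPowerSeriesOnBall_polyChart`); `polyChart_eq_jet26` — its whole Taylor split has no rest (✓`polyChart_zero`,
  ✓`fderiv_polyChart_zero`).
* §2 LEG-INDEXED KERNELS on a product chart space `ι → 𝕍`: `diagKernel_apply_diag` (`(Σ_c N_n(c) ∘ (proj c₁, …, proj c_n))(x,…,x) = Σ_c N_n(c)(x(c₁),…)`) and `legPoly_eq_polyChart`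
  (`P_N` IS the diagonal polynomial of these diagonal kernels), hence ★ **`jet26_legPoly`** (`jet26 P_N = P_N`), `legPoly_zero`, `fderiv_legPoly_zero`, `differentiable_legPoly`; the
  leg-weighted size `norm_legKernel_apply_smul_le` (`|N_n(c)(w(c₁)x(c₁),…)| ≤ ‖N_n(c)‖·Πᵢ‖w(cᵢ)‖·‖x‖ⁿ`, `map_smul_univ` + `le_opNorm`) and ★ **`chartAnalyticityAsCited_legPoly_comp_diag`**
  — the (R2′) clause of `P_N ∘ D_w` from the LEG-WEIGHTED KERNEL BUDGET `Σ_{n∈[2,7)} (n!)⁻¹ Σ_c ‖N_n(c)‖·Πᵢ‖w(cᵢ)‖·(ρ/2)ⁿ ≤ M` (at the leg weights `w = e^{κ′d(·)}` this is print's (43)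
  decay `|𝒫_j(Y_j)| ≤ O(1)·Πᵢ e^{−κ₁ d(cᵢ)}` with `κ′ < κ₁`).
* §3 THE NATURAL CHART FAMILY `Φ♮[Φ₀, N] K b Y := if ∃ y, blockSet K (1+b) y = Y then P_{N K b y} else Φ₀ K b Y` (blocks first; `Φ₀` a background family — at the door
  `birthChartRows q`), INLINE: `naturalChart_blockSet`, `naturalChart_of_forall_ne` (= (N)'s chart clause `Φ♮ K k (domSet X) = Φ₀ K k (domSet X)` as soon as `domSet X` is no block's
  point set — the geometric letter of `M₁ ≠ L`; with `L ≤ M₁` such a domain is one cube, ✓`dj_eq_zero_of_domSet_eq_blockSet`), ★ **`jet26_naturalChart_blockSet`** (the (M1) identity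
  `jet26 (Φ♮ K b (blockSet y)) x = P_{N K b y} x`), `rescaleΦw_naturalChart_blockSet`, ★ **`chartAnalyticityAsCited_rescaleW_naturalChart_blockSet`** ((R2′)'s old-block clause of
  `rescaleΦw dist κ′ Φ♮` from the budget at the weights `e^{κ′·dist}`, `norm_legW`).
* §4 AT THE TREE'S OBJECTS (`𝕍 := 𝔤ᶜ`, `Φ₀ := birthChartRows q` for a rows record `q : ∀ K, PkgCoreRows …`, the natural configuration family `B♮ᴿ` of ✓`…LegCfgDistNaturalRows`, the
  v4 displays `NewLevelIsBirthRows` / `OldTermsAreJetsOwnRows` of ✓p623412): **`newLevelIsBirthRows_naturalRows`** — (N) for the canonical triple `(birthChartRows q, 0, B♮ᴿ)`;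
  ★ **`newLevelIsBirthRows_naturalChart`** — (N) for `(Φ♮[birthChartRows q, N], 0, B♮ᴿ)` under the geometric letter `hsep` «no retained step-`k` domain of run `K` has the point set
  of a level-`(k+1)` block»; ★★ **`oldTermsAreJetsOwnRows_natural_of_kernelRow`** — (M1) `OldTermsAreJetsOwnRows q Φ♮[birthChartRows q, N] 0 B♮ᴿ` FROM PRINT'S (43) AS A ROW ON THE
  RECORD: «for `k + 1 ≤ K`, `j < k`, every old block `y` of level `1 + j` and every `W`, `oldTermRows q K k (1+j) y W = Re Σ_{n∈[2,7)} (n!)⁻¹ Σ_c N K j y n c (B♮ᴿ K (k+1) j (blockSet y) W ∘ c)`»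
  (two lines: the row, `jet26_naturalChart_blockSet`).  So in the door display the pair {(N), (M1)} for the natural objects is EQUIVALENT-IN-USE to {`hsep`, the (43) kernel row}, both
  print-shaped letters a definer of `𝔖_Bal` reads off his construction.

HONEST SCOPE.  Functional-analytic bookkeeping over Mathlib and ✓p623011; the kernel family `N` and the row «old terms = `Re P_N(B♮ᴿ)`» are HYPOTHESES a definer of the (α) record
discharges by defining `StepSeries.oldVal` in print's form (43); nothing of [Balaban1985UV3] / [King1986] is asserted; (R1), the new-level (R2′) and (R5) are untouched; no summit /
rung / gap claim (YM₃ on T³ is ladder rung R3, not the Clay problem).  L-floor: none.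

References: T. Bałaban, CMP 102 (1985) 255–275 [Balaban1985UV3] ((30) p.263, p.264 L18–20, (33)–(34) p.264, (43)–(44) pp.266–267, (57) p.270); C. King, CMP 102 (1986) 649–677
[King1986] ((3.55) p.662).
-/

set_option autoImplicit false

noncomputable section

open scoped BigOperators Nat
open Metric
open Literature.MathematicalPhysics.QuantumFieldTheory.Balaban1983to89
open Literature.MathematicalPhysics.QuantumFieldTheory.Balaban1983to89.T3ContinuumYM3Torus
open Literature.MathematicalPhysics.QuantumFieldTheory.Balaban1985CMP102
open Literature.MathematicalPhysics.QuantumFieldTheory.Balaban1985CMP102.Setting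
open Literature.MathematicalPhysics.QuantumFieldTheory.Balaban1985CMP102.Binders (ChartAnalyticityAsCited)
open Summit.QuantumFields.Balaban3D.Proofs.Representation33 (jet26)
open Summit.QuantumFields.YangMills.Theorems
open Summit.QuantumFields.YangMills.Theorems.TwoCutoffTowerLimit
open Summit.QuantumFields.YangMills.Theorems.GlobalSlackKernelMatching
open Summit.QuantumFields.YangMills.Theorems.GlobalSlackCanonicalPolymers

namespace Summit.QuantumFields.YangMills.Theorems.GlobalSlackKernelLeg

/-! ## §1 The diagonal kernel polynomial is its own order-2…6 jet -/

section Jet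

variable {E : Type*} [NormedAddCommGroup E] [NormedSpace ℂ E]

/-- **THE FLAT DERIVATIVES OF THE KERNEL POLYNOMIAL ON THE DIAGONAL** (no symmetry asked): `D^d P_M(0)(x,…,x) = M_d(x,…,x)` for `d ∈ [2,7)` (Mathlib `HasFPowerSeriesOnBall.factorial_smul`
on ✓`hasFiniteFPowerSeriesOnBall_polyChart`). [folklore] -/
theorem iteratedFDeriv_polyChart_apply_diag (M : (n : ℕ) → ContinuousMultilinearMap ℂ (fun _ : Fin n => E) ℂ) {d : ℕ} (hd : d ∈ Finset.Ico 2 7) (x : E) :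
    iteratedFDeriv ℂ d (fun x : E => ∑ n ∈ Finset.Ico 2 7, ((n ! : ℂ))⁻¹ * M n (fun _ => x)) 0 (fun _ => x) = M d (fun _ => x) := by
  have h := (hasFiniteFPowerSeriesOnBall_polyChart M).toHasFPowerSeriesOnBall.factorial_smul x d
  rw [← h]
  simp only [hd, if_true, smul_apply, smul_eq_mul, nsmul_eq_mul]
  have hd0 : ((d ! : ℂ)) ≠ 0 := by exact_mod_cast Nat.factorial_ne_zero d
  field_simp

/-- ★ **`jet26 P_M = P_M`**: the kernel polynomial `P_M(x) = Σ_{n∈[2,7)} (n!)⁻¹·M_n(x,…,x)` is its own order-2…6 jet at `0` («polynomials in B of at least the second order, and at most the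
sixth order», the middle sum of (30)). [cite: Balaban1985UV3, (30) p.263, p.264 L18-20] -/
theorem jet26_polyChart (M : (n : ℕ) → ContinuousMultilinearMap ℂ (fun _ : Fin n => E) ℂ) (x : E) :
    jet26 (fun x : E => ∑ n ∈ Finset.Ico 2 7, ((n ! : ℂ))⁻¹ * M n (fun _ => x)) x = ∑ n ∈ Finset.Ico 2 7, ((n ! : ℂ))⁻¹ * M n (fun _ => x) := by
  unfold jet26
  refine Finset.sum_congr rfl fun n hn => ?_
  rw [iteratedFDeriv_polyChart_apply_diag M hn x, smul_eq_mul]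

/-- **THE WHOLE TAYLOR SPLIT OF A KERNEL POLYNOMIAL HAS NO REST**: `P_M x = P_M 0 + DP_M(0) x + jet26 P_M x` (the first two terms vanish: ✓`polyChart_zero`, ✓`fderiv_polyChart_zero`).
[cite: Balaban1985UV3, (30)-(32) pp.263-264] -/
theorem polyChart_eq_jet26 (M : (n : ℕ) → ContinuousMultilinearMap ℂ (fun _ : Fin n => E) ℂ) (x : E) :
    (∑ n ∈ Finset.Ico 2 7, ((n ! : ℂ))⁻¹ * M n (fun _ => x)) =
      (fun x : E => ∑ n ∈ Finset.Ico 2 7, ((n ! : ℂ))⁻¹ * M n (fun _ => x)) 0 +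
        fderiv ℂ (fun x : E => ∑ n ∈ Finset.Ico 2 7, ((n ! : ℂ))⁻¹ * M n (fun _ => x)) 0 x +
        jet26 (fun x : E => ∑ n ∈ Finset.Ico 2 7, ((n ! : ℂ))⁻¹ * M n (fun _ => x)) x := by
  rw [polyChart_zero, fderiv_polyChart_zero, jet26_polyChart]
  simp

end Jet

/-! ## §2 Leg-indexed kernels on a product chart space `ι → 𝕍` -/

section Legs

variable {ι : Type*} [Fintype ι] {𝕍 : Type*} [NormedAddCommGroup 𝕍] [NormedSpace ℂ 𝕍]
  (N : (n : ℕ) → (Fin n → ι) → ContinuousMultilinearMap ℂ (fun _ : Fin n => 𝕍) ℂ)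

/-- **THE DIAGONAL KERNEL OF A LEG-INDEXED KERNEL FAMILY, READ ON THE DIAGONAL**: `(Σ_c N_n(c) ∘ (proj c₁,…,proj c_n))(x,…,x) = Σ_c N_n(c)(x(c₁),…,x(c_n))`. [folklore] -/
theorem diagKernel_apply_diag (n : ℕ) (x : ι → 𝕍) :
    (∑ c : Fin n → ι, (N n c).compContinuousLinearMap fun i => (ContinuousLinearMap.proj (c i) : (ι → 𝕍) →L[ℂ] 𝕍)) (fun _ => x) =
      ∑ c : Fin n → ι, N n c (fun i => x (c i)) := by
  rw [sum_apply]
  refine Finset.sum_congr rfl fun c _ => ?_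
  rw [ContinuousMultilinearMap.compContinuousLinearMap_apply]
  rfl

/-- **THE LEG-INDEXED KERNEL POLYNOMIAL IS THE DIAGONAL POLYNOMIAL OF ITS DIAGONAL KERNELS**:
`Σ_{n∈[2,7)} (n!)⁻¹ Σ_c N_n(c)(x(c₁),…,x(c_n)) = Σ_{n∈[2,7)} (n!)⁻¹·(Σ_c N_n(c) ∘ proj^c)(x,…,x)`. [cite: Balaban1985UV3, (43) p.266; King1986, (3.55) p.662] -/
theorem legPoly_eq_polyChart :
    (fun x : ι → 𝕍 => ∑ n ∈ Finset.Ico 2 7, ((n ! : ℂ))⁻¹ * ∑ c : Fin n → ι, N n c (fun i => x (c i))) =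
      fun x : ι → 𝕍 => ∑ n ∈ Finset.Ico 2 7, ((n ! : ℂ))⁻¹ *
        (∑ c : Fin n → ι, (N n c).compContinuousLinearMap fun i => (ContinuousLinearMap.proj (c i) : (ι → 𝕍) →L[ℂ] 𝕍)) (fun _ => x) := by
  funext x
  refine Finset.sum_congr rfl fun n _ => ?_
  rw [diagKernel_apply_diag]

/-- ★ **`jet26 P_N = P_N` FOR THE LEG-INDEXED KERNEL POLYNOMIAL** (print's «⟨𝒫_j(Y_j), B(c₁), …, B(c_n)⟩, n ≥ 2 … at most the sixth order» is its own order-2…6 jet).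
[cite: Balaban1985UV3, (43) p.266, (30) p.263] -/
theorem jet26_legPoly (x : ι → 𝕍) :
    jet26 (fun x : ι → 𝕍 => ∑ n ∈ Finset.Ico 2 7, ((n ! : ℂ))⁻¹ * ∑ c : Fin n → ι, N n c (fun i => x (c i))) x =
      ∑ n ∈ Finset.Ico 2 7, ((n ! : ℂ))⁻¹ * ∑ c : Fin n → ι, N n c (fun i => x (c i)) := by
  rw [legPoly_eq_polyChart, jet26_polyChart]
  refine Finset.sum_congr rfl fun n _ => ?_
  rw [diagKernel_apply_diag]

/-- The leg-indexed kernel polynomial vanishes at `0` (every order is `≥ 2`). [folklore] -/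
theorem legPoly_zero : (fun x : ι → 𝕍 => ∑ n ∈ Finset.Ico 2 7, ((n ! : ℂ))⁻¹ * ∑ c : Fin n → ι, N n c (fun i => x (c i))) 0 = 0 := by
  rw [legPoly_eq_polyChart]
  exact polyChart_zero _

/-- The leg-indexed kernel polynomial has no linear term ((32)-shape). [cite: Balaban1985UV3, (32) p.264] -/
theorem fderiv_legPoly_zero : fderiv ℂ (fun x : ι → 𝕍 => ∑ n ∈ Finset.Ico 2 7, ((n ! : ℂ))⁻¹ * ∑ c : Fin n → ι, N n c (fun i => x (c i))) 0 = 0 := by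
  rw [legPoly_eq_polyChart]
  exact fderiv_polyChart_zero _

/-- The leg-indexed kernel polynomial is entire. [folklore] -/
theorem differentiable_legPoly : Differentiable ℂ (fun x : ι → 𝕍 => ∑ n ∈ Finset.Ico 2 7, ((n ! : ℂ))⁻¹ * ∑ c : Fin n → ι, N n c (fun i => x (c i))) := by
  rw [legPoly_eq_polyChart]
  exact differentiable_polyChart _

/-- **LEG-WEIGHTED SIZE OF ONE KERNEL TERM**: for weights `w : ι → ℂ`, `‖N_n(c)(w(c₁)•x(c₁), …, w(c_n)•x(c_n))‖ ≤ ‖N_n(c)‖·(Πᵢ ‖w(cᵢ)‖)·‖x‖ⁿ` (`map_smul_univ`, `le_opNorm`, the sup norm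
of the product). [folklore] -/
theorem norm_legKernel_apply_smul_le (w : ι → ℂ) (n : ℕ) (c : Fin n → ι) (x : ι → 𝕍) :
    ‖N n c (fun i => w (c i) • x (c i))‖ ≤ ‖N n c‖ * (∏ i, ‖w (c i)‖) * ‖x‖ ^ n := by
  rw [ContinuousMultilinearMap.map_smul_univ, norm_smul, norm_prod]
  have h1 : ‖N n c (fun i => x (c i))‖ ≤ ‖N n c‖ * ‖x‖ ^ n := by
    calc ‖N n c (fun i => x (c i))‖ ≤ ‖N n c‖ * ∏ i : Fin n, ‖x (c i)‖ := ContinuousMultilinearMap.le_opNorm _ _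
      _ ≤ ‖N n c‖ * ∏ _i : Fin n, ‖x‖ := by
          refine mul_le_mul_of_nonneg_left (Finset.prod_le_prod (fun i _ => norm_nonneg _) fun i _ => norm_le_pi_norm x (c i)) (norm_nonneg _)
      _ = ‖N n c‖ * ‖x‖ ^ n := by rw [Finset.prod_const, Finset.card_univ, Fintype.card_fin]
  calc (∏ i, ‖w (c i)‖) * ‖N n c (fun i => x (c i))‖ ≤ (∏ i, ‖w (c i)‖) * (‖N n c‖ * ‖x‖ ^ n) :=
        mul_le_mul_of_nonneg_left h1 (Finset.prod_nonneg fun i _ => norm_nonneg _)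
    _ = _ := by ring

/-- **SIZE OF THE LEG-INDEXED KERNEL POLYNOMIAL READ THROUGH A DIAGONAL WEIGHT**: `‖P_N(w•z)‖ ≤ Σ_{n∈[2,7)} (n!)⁻¹ Σ_c ‖N_n(c)‖·(Πᵢ‖w(cᵢ)‖)·‖z‖ⁿ`. [folklore] -/
theorem norm_legPoly_smul_le (w : ι → ℂ) (z : ι → 𝕍) :
    ‖∑ n ∈ Finset.Ico 2 7, ((n ! : ℂ))⁻¹ * ∑ c : Fin n → ι, N n c (fun i => (fun j => w j • z j) (c i))‖ ≤
      ∑ n ∈ Finset.Ico 2 7, ((n ! : ℝ))⁻¹ * ∑ c : Fin n → ι, ‖N n c‖ * (∏ i, ‖w (c i)‖) * ‖z‖ ^ n := by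
  refine (norm_sum_le _ _).trans (Finset.sum_le_sum fun n _ => ?_)
  rw [norm_mul, norm_inv, Complex.norm_natCast]
  refine mul_le_mul_of_nonneg_left ((norm_sum_le _ _).trans (Finset.sum_le_sum fun c _ => ?_)) (by positivity)
  exact norm_legKernel_apply_smul_le N w n c z

/-- ★ **THE (R2′) CLAUSE OF A LEG-INDEXED KERNEL POLYNOMIAL READ THROUGH A DIAGONAL WEIGHT, FROM THE LEG-WEIGHTED KERNEL BUDGET**: for `0 < ρ`, weights `w` (`w(c) ≠ 0`) and
`Σ_{n∈[2,7)} (n!)⁻¹ Σ_c ‖N_n(c)‖·(Πᵢ‖w(cᵢ)‖)·(ρ/2)ⁿ ≤ M`, the chart `z ↦ P_N(D_w z)` is `ChartAnalyticityAsCited … ρ M` (entire; bounded by `M` on `closedBall 0 (ρ/2)`).  At the leg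
weights `w = e^{κ′d(·)}` of `legD` the budget is print's (43) kernel decay with `κ′ < κ₁`. [cite: Balaban1985UV3, (43) p.266, (25) p.262; King1986, (3.55) p.662] -/
theorem chartAnalyticityAsCited_legPoly_comp_diag (w : ι → ℂ) (hw : ∀ c, w c ≠ 0) {ρ M : ℝ} (hρ : 0 < ρ)
    (hM : ∑ n ∈ Finset.Ico 2 7, ((n ! : ℝ))⁻¹ * ∑ c : Fin n → ι, ‖N n c‖ * (∏ i, ‖w (c i)‖) * (ρ / 2) ^ n ≤ M) :
    ChartAnalyticityAsCited (fun z : ι → 𝕍 => (fun x : ι → 𝕍 => ∑ n ∈ Finset.Ico 2 7, ((n ! : ℂ))⁻¹ * ∑ c : Fin n → ι, N n c (fun i => x (c i)))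
      (diagEquiv (E := 𝕍) w hw z)) ρ M := by
  refine ⟨hρ, ((differentiable_legPoly N).comp (diagEquiv (E := 𝕍) w hw).differentiable).differentiableOn, fun z hz => ?_⟩
  rw [mem_closedBall, dist_zero_right] at hz
  have hdiag : (diagEquiv (E := 𝕍) w hw z : ι → 𝕍) = fun j => w j • z j := funext fun j => diagEquiv_apply w hw z j
  dsimp only
  rw [hdiag]
  refine (norm_legPoly_smul_le N w z).trans (le_trans (Finset.sum_le_sum fun n _ => ?_) hM)
  refine mul_le_mul_of_nonneg_left (Finset.sum_le_sum fun c _ => ?_) (by positivity)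
  exact mul_le_mul_of_nonneg_left (pow_le_pow_left₀ (norm_nonneg _) hz n) (by positivity)

end Legs

/-! ## §3 The natural chart family `Φ♮[Φ₀, N]`: kernel polynomials on the old blocks, the background family elsewhere -/

section NaturalChart

variable {F : T3Family} {𝕍 : Type} [NormedAddCommGroup 𝕍] [NormedSpace ℂ 𝕍]
  (Φ₀ : ChartFam 𝕍 F)
  (N : (K b : ℕ) → Site (F.P K) (1 + b) → (n : ℕ) → (Fin n → PBond (F.P K) b) → ContinuousMultilinearMap ℂ (fun _ : Fin n => 𝕍) ℂ)

open Classical in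
/-- **AT AN OLD BLOCK THE NATURAL CHART IS THE KERNEL POLYNOMIAL OF THAT BLOCK** (`1 + b ≤ m + K`, so that `blockSet K (1+b)` is injective). [cite: Balaban1985UV3, (43) p.266] -/
theorem naturalChart_blockSet {K b : ℕ} (hb : 1 + b ≤ F.m + K) (y : Site (F.P K) (1 + b)) :
    (fun K b Y =>
        if h : ∃ y : Site (F.P K) (1 + b), blockSet K (1 + b) y = Y then
          (fun x : PBond (F.P K) b → 𝕍 => ∑ n ∈ Finset.Ico 2 7, ((n ! : ℂ))⁻¹ * ∑ c : Fin n → PBond (F.P K) b, N K b h.choose n c (fun i => x (c i)))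
        else Φ₀ K b Y : ChartFam 𝕍 F) K b (blockSet K (1 + b) y) =
      fun x => ∑ n ∈ Finset.Ico 2 7, ((n ! : ℂ))⁻¹ * ∑ c : Fin n → PBond (F.P K) b, N K b y n c (fun i => x (c i)) := by
  have h : ∃ y' : Site (F.P K) (1 + b), blockSet K (1 + b) y' = blockSet K (1 + b) y := ⟨y, rfl⟩
  have hy : h.choose = y := blockSet_injective K (1 + b) hb h.choose_spec
  dsimp only
  rw [dif_pos h, hy]

open Classical in
/-- **OFF THE OLD BLOCKS THE NATURAL CHART IS THE BACKGROUND CHART**: if `Y` is the point set of no level-`(1+b)` block, `Φ♮ K b Y = Φ₀ K b Y` — in particular (N)'s chart clause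
`Φ♮ K k (domSet X) = birthChartRows q K k (domSet X)` at `Φ₀ := birthChartRows q` under the geometric letter «no retained step-`k` domain has the point set of a level-`(k+1)` block»
(`M₁ ≠ L`). [cite: Balaban1985UV3, (33) p.264, (59)-(61) pp.270-271] -/
theorem naturalChart_of_forall_ne {K b : ℕ} {Y : Set (Site (F.P K) 0)} (hY : ∀ y : Site (F.P K) (1 + b), blockSet K (1 + b) y ≠ Y) :
    (fun K b Y =>
        if h : ∃ y : Site (F.P K) (1 + b), blockSet K (1 + b) y = Y then
          (fun x : PBond (F.P K) b → 𝕍 => ∑ n ∈ Finset.Ico 2 7, ((n ! : ℂ))⁻¹ * ∑ c : Fin n → PBond (F.P K) b, N K b h.choose n c (fun i => x (c i)))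
        else Φ₀ K b Y : ChartFam 𝕍 F) K b Y = Φ₀ K b Y := by
  have h : ¬ ∃ y : Site (F.P K) (1 + b), blockSet K (1 + b) y = Y := fun ⟨y, hy⟩ => hY y hy
  dsimp only
  rw [dif_neg h]

open Classical in
/-- ★ **AT AN OLD BLOCK THE JET OF THE NATURAL CHART IS THE KERNEL POLYNOMIAL ITSELF**: `jet26 (Φ♮ K b (blockSet y)) x = P_{N K b y} x` (`naturalChart_blockSet`, `jet26_legPoly`) —
with `e := 0` the right-hand side of (M1) at `Φ♮` reads `Re Σ_n (n!)⁻¹ Σ_c N_n(c)(B(c₁),…,B(c_n))` at `B = B♮ᴿ K (k+1) j (blockSet y) W`, print's (43) verbatim. [cite: Balaban1985UV3, (43) p.266, (30) p.263] -/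
theorem jet26_naturalChart_blockSet {K b : ℕ} (hb : 1 + b ≤ F.m + K) (y : Site (F.P K) (1 + b)) (x : PBond (F.P K) b → 𝕍) :
    jet26 ((fun K b Y =>
        if h : ∃ y : Site (F.P K) (1 + b), blockSet K (1 + b) y = Y then
          (fun x : PBond (F.P K) b → 𝕍 => ∑ n ∈ Finset.Ico 2 7, ((n ! : ℂ))⁻¹ * ∑ c : Fin n → PBond (F.P K) b, N K b h.choose n c (fun i => x (c i)))
        else Φ₀ K b Y : ChartFam 𝕍 F) K b (blockSet K (1 + b) y)) x =
      ∑ n ∈ Finset.Ico 2 7, ((n ! : ℂ))⁻¹ * ∑ c : Fin n → PBond (F.P K) b, N K b y n c (fun i => x (c i)) := by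
  rw [naturalChart_blockSet Φ₀ N hb y, jet26_legPoly]

open Classical in
/-- **THE LEG-RESCALED NATURAL CHART AT AN OLD BLOCK IS THE KERNEL POLYNOMIAL READ THROUGH THE WEIGHT MAP**: `(rescaleΦw dist κ′ Φ♮) K b (blockSet y) = P_{N K b y} ∘ D_w`.
[cite: Balaban1985UV3, (43) p.266, (45) p.267] -/
theorem rescaleΦw_naturalChart_blockSet (dist : LegDist F) (κ' : ℝ) {K b : ℕ} (hb : 1 + b ≤ F.m + K) (y : Site (F.P K) (1 + b)) :
    rescaleΦw dist κ' (fun K b Y =>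
        if h : ∃ y : Site (F.P K) (1 + b), blockSet K (1 + b) y = Y then
          (fun x : PBond (F.P K) b → 𝕍 => ∑ n ∈ Finset.Ico 2 7, ((n ! : ℂ))⁻¹ * ∑ c : Fin n → PBond (F.P K) b, N K b h.choose n c (fun i => x (c i)))
        else Φ₀ K b Y : ChartFam 𝕍 F) K b (blockSet K (1 + b) y) =
      fun z => (fun x : PBond (F.P K) b → 𝕍 => ∑ n ∈ Finset.Ico 2 7, ((n ! : ℂ))⁻¹ * ∑ c : Fin n → PBond (F.P K) b, N K b y n c (fun i => x (c i)))
        (legD 𝕍 dist κ' K b (blockSet K (1 + b) y) z) := by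
  funext z
  exact congrFun (naturalChart_blockSet Φ₀ N hb y) (legD 𝕍 dist κ' K b (blockSet K (1 + b) y) z)

open Classical in
/-- ★ **(R2′)'s OLD-BLOCK CLAUSE FOR `Φ♮[Φ₀, N]` FROM THE LEG-WEIGHTED KERNEL BUDGET**: at an old block `Y = blockSet K (1+b) y`, the leg-rescaled natural chart `Φ♮ K b Y ∘ D_w` is
`ChartAnalyticityAsCited … ρ M` as soon as `Σ_{n∈[2,7)} (n!)⁻¹ Σ_c ‖N K b y n c‖·(Πᵢ e^{κ′·dist(cᵢ)})·(ρ/2)ⁿ ≤ M` (`chartAnalyticityAsCited_legPoly_comp_diag` at the leg weights, `norm_legW`).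
[cite: Balaban1985UV3, (43) p.266, (25) p.262, (45) p.267; King1986, (3.55) p.662] -/
theorem chartAnalyticityAsCited_rescaleW_naturalChart_blockSet (dist : LegDist F) (κ' : ℝ) {K b : ℕ} (hb : 1 + b ≤ F.m + K) (y : Site (F.P K) (1 + b))
    {ρ M : ℝ} (hρ : 0 < ρ)
    (hM : ∑ n ∈ Finset.Ico 2 7, ((n ! : ℝ))⁻¹ * ∑ c : Fin n → PBond (F.P K) b,
        ‖N K b y n c‖ * (∏ i, Real.exp (κ' * dist K b (blockSet K (1 + b) y) (c i))) * (ρ / 2) ^ n ≤ M) :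
    ChartAnalyticityAsCited (rescaleΦw dist κ' (fun K b Y =>
        if h : ∃ y : Site (F.P K) (1 + b), blockSet K (1 + b) y = Y then
          (fun x : PBond (F.P K) b → 𝕍 => ∑ n ∈ Finset.Ico 2 7, ((n ! : ℂ))⁻¹ * ∑ c : Fin n → PBond (F.P K) b, N K b h.choose n c (fun i => x (c i)))
        else Φ₀ K b Y : ChartFam 𝕍 F) K b (blockSet K (1 + b) y)) ρ M := by
  rw [rescaleΦw_naturalChart_blockSet Φ₀ N dist κ' hb y]
  have hM' : ∑ n ∈ Finset.Ico 2 7, ((n ! : ℝ))⁻¹ * ∑ c : Fin n → PBond (F.P K) b,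
      ‖N K b y n c‖ * (∏ i, ‖legW dist κ' K b (blockSet K (1 + b) y) (c i)‖) * (ρ / 2) ^ n ≤ M := by
    simp only [norm_legW]
    exact hM
  exact chartAnalyticityAsCited_legPoly_comp_diag (N K b y) (legW dist κ' K b (blockSet K (1 + b) y)) (legW_ne_zero dist κ' K b (blockSet K (1 + b) y)) hρ hM'

end NaturalChart

/-! ## §4 At the tree's objects: (N) and (M1) for the natural chart and configuration families of a rows record -/

section Record

open scoped Matrix.Norms.L2Operator
open Literature.MathematicalPhysics.QuantumFieldTheory.Balaban1983to89.T3UnitLawDensityEML (ℰp)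
open Literature.MathematicalPhysics.QuantumFieldTheory.Balaban1983to89.T3UnitScaleTilt (θBal)
open Literature.MathematicalPhysics.QuantumFieldTheory.Balaban1983to89.TreeLengthTorus (tsys)
open Literature.MathematicalPhysics.QuantumFieldTheory.Balaban1983to89.B10Eq27TorusAxialLog
open Literature.MathematicalPhysics.QuantumFieldTheory.Balaban1983to89.B7Prop1Explicit (l1)
open Summit.QuantumFields.Balaban3D.Carriers
open Summit.QuantumFields.Balaban3D.Proofs.Primitives
open Summit.QuantumFields.Balaban3D.Proofs.GroupModelLieC (vecE lieC)

variable {F : T3Family} {𝔠 : AlphaConsts F.L (suGroupModel 2).N} {γ : ℝ} {hγ : 0 < γ} {hγ1 : γ ≤ (min 𝔠.gamma0 1) ^ 2}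
  (q : ∀ K, AlphaInputsT3AC.PkgCoreRows F 𝔠 γ hγ hγ1 K)

open Classical in
/-- **(N) `NewLevelIsBirthRows` FOR THE CANONICAL TRIPLE `(birthChartRows q, 0, B♮ᴿ)`** of every rows record `q` (the chart and vacuum-constant clauses by `rfl`, the configuration clause by
✓`naturalRows_newLevel_eq_bcfg`). [cite: Balaban1985UV3, (33) p.264, (60)-(61) p.271] -/
theorem newLevelIsBirthRows_naturalRows {p₁ : ℝ} :
    NewLevelIsBirthRows q (birthChartRows q) (fun _ _ _ => 0)
      (fun K k b Y W c =>
        if h : b + 1 = k then birthCfgAtRows q K b Y (h ▸ W) c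
        else if (l1 (rel (anchors_nonempty (F := F) K b Y).choose c.src) : ℝ) *
            (2 * (𝔠.B₃ * θBal F.L γ 𝔠.b₀ p₁ (K - k)) * (((F.L : ℝ) ^ (k - b))⁻¹) ^ 2) ≤ 1 / 2 then
          (lieC (suGroupModel 2)).orthogonalProjectionOnto
            (vecE (suGroupModel 2).N
              (B27T (unitsField (toUField (Averaging.iter (fun i => BlockAveraging.blockAvg (P := F.P K) (j := i) ℰp) b
                ((q K).UkH k (Hist.triv (F.P K) k) W)))) (anchors_nonempty (F := F) K b Y).choose c))
        else 0) := by
  intro K k hk X hX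
  exact ⟨rfl, rfl, fun W => naturalRows_newLevel_eq_bcfg q K k hk X hX W⟩

variable (N : (K b : ℕ) → Site (F.P K) (1 + b) → (n : ℕ) → (Fin n → PBond (F.P K) b) → ContinuousMultilinearMap ℂ (fun _ : Fin n => ↥(lieC (suGroupModel 2))) ℂ)

open Classical in
/-- ★ **(N) `NewLevelIsBirthRows` FOR THE NATURAL TRIPLE `(Φ♮[birthChartRows q, N], 0, B♮ᴿ)`** under the geometric letter `hsep` «no retained step-`k` domain of run `K` (trivial
history, `k + 1 ≤ K`) has the point set of a level-`(k+1)` block» (the chart clause by `naturalChart_of_forall_ne`, the configuration clause by ✓`naturalRows_newLevel_eq_bcfg`).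
[cite: Balaban1985UV3, (33) p.264, (59)-(61) pp.270-271] -/
theorem newLevelIsBirthRows_naturalChart {p₁ : ℝ}
    (hsep : ∀ (K k : ℕ), k + 1 ≤ K → ∀ X ∈ newDomsRows q K k (Hist.triv (F.P K) (k + 1)), ∀ y : Site (F.P K) (1 + k),
      blockSet K (1 + k) y ≠ domSet (F := F) 𝔠.lane.carrier.M₁ K k X) :
    NewLevelIsBirthRows q
      (fun K b Y =>
        if h : ∃ y : Site (F.P K) (1 + b), blockSet K (1 + b) y = Y then
          (fun x : PBond (F.P K) b → ↥(lieC (suGroupModel 2)) =>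
            ∑ n ∈ Finset.Ico 2 7, ((n ! : ℂ))⁻¹ * ∑ c : Fin n → PBond (F.P K) b, N K b h.choose n c (fun i => x (c i)))
        else birthChartRows q K b Y)
      (fun _ _ _ => 0)
      (fun K k b Y W c =>
        if h : b + 1 = k then birthCfgAtRows q K b Y (h ▸ W) c
        else if (l1 (rel (anchors_nonempty (F := F) K b Y).choose c.src) : ℝ) *
            (2 * (𝔠.B₃ * θBal F.L γ 𝔠.b₀ p₁ (K - k)) * (((F.L : ℝ) ^ (k - b))⁻¹) ^ 2) ≤ 1 / 2 then
          (lieC (suGroupModel 2)).orthogonalProjectionOnto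
            (vecE (suGroupModel 2).N
              (B27T (unitsField (toUField (Averaging.iter (fun i => BlockAveraging.blockAvg (P := F.P K) (j := i) ℰp) b
                ((q K).UkH k (Hist.triv (F.P K) k) W)))) (anchors_nonempty (F := F) K b Y).choose c))
        else 0) := by
  intro K k hk X hX
  exact ⟨naturalChart_of_forall_ne (birthChartRows q) N (hsep K k hk X hX), rfl, fun W => naturalRows_newLevel_eq_bcfg q K k hk X hX W⟩

open Classical in
/-- ★★ **(M1) `OldTermsAreJetsOwnRows` FOR THE NATURAL TRIPLE FROM PRINT'S (43) AS A ROW ON THE RECORD**: if the record's previous-scale terms at the trivial history ARE the leg-indexed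
kernel polynomials read at the natural loop variables — «for `k + 1 ≤ K`, `j < k`, every old block `y` of level `1 + j`, every `W`,
`oldTermRows q K k (1+j) y W = Re Σ_{n∈[2,7)} (n!)⁻¹ Σ_{c : Fin n → bonds} N K j y n c (B♮ᴿ K (k+1) j (blockSet y) W (c₁), …)`», print's «𝒫_j(Y_j, U_k) = ⟨𝒫_j(Y_j), B_k(c₁), …, B_k(c_n)⟩»
with field-independent kernels `N` — then (M1) holds for `(Φ♮[birthChartRows q, N], 0, B♮ᴿ)` (the row, then `jet26_naturalChart_blockSet`).  The row is a HYPOTHESIS, the definer's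
specification of `StepSeries.oldVal`; nothing is asserted. [cite: Balaban1985UV3, (43) p.266, (33)-(34) p.264, (30) p.263] -/
theorem oldTermsAreJetsOwnRows_natural_of_kernelRow {p₁ : ℝ}
    (hK : ∀ (K k : ℕ), k + 1 ≤ K → ∀ j : ℕ, j < k →
      ∀ y ∈ oldBlocks 𝔠.lane.carrier.M₁ (rcolOf (SK F 𝔠 γ hγ hγ1 K) 𝔠.lane.carrier) (Hist.triv (F.P K) (k + 1)) (1 + j),
        ∀ W : GaugeField (F.P K) (k + 1) (Matrix.specialUnitaryGroup (Fin 2) ℂ),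
          oldTermRows q K k (1 + j) y W =
            (∑ n ∈ Finset.Ico 2 7, ((n ! : ℂ))⁻¹ * ∑ c : Fin n → PBond (F.P K) j, N K j y n c (fun i =>
              (fun K k b Y W c =>
                if h : b + 1 = k then birthCfgAtRows q K b Y (h ▸ W) c
                else if (l1 (rel (anchors_nonempty (F := F) K b Y).choose c.src) : ℝ) *
                    (2 * (𝔠.B₃ * θBal F.L γ 𝔠.b₀ p₁ (K - k)) * (((F.L : ℝ) ^ (k - b))⁻¹) ^ 2) ≤ 1 / 2 then
                  (lieC (suGroupModel 2)).orthogonalProjectionOnto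
                    (vecE (suGroupModel 2).N
                      (B27T (unitsField (toUField (Averaging.iter (fun i => BlockAveraging.blockAvg (P := F.P K) (j := i) ℰp) b
                        ((q K).UkH k (Hist.triv (F.P K) k) W)))) (anchors_nonempty (F := F) K b Y).choose c))
                else 0) K (k + 1) j (blockSet K (1 + j) y) W (c i))).re) :
    OldTermsAreJetsOwnRows q
      (fun K b Y =>
        if h : ∃ y : Site (F.P K) (1 + b), blockSet K (1 + b) y = Y then
          (fun x : PBond (F.P K) b → ↥(lieC (suGroupModel 2)) =>
            ∑ n ∈ Finset.Ico 2 7, ((n ! : ℂ))⁻¹ * ∑ c : Fin n → PBond (F.P K) b, N K b h.choose n c (fun i => x (c i)))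
        else birthChartRows q K b Y)
      (fun _ _ _ => 0)
      (fun K k b Y W c =>
        if h : b + 1 = k then birthCfgAtRows q K b Y (h ▸ W) c
        else if (l1 (rel (anchors_nonempty (F := F) K b Y).choose c.src) : ℝ) *
            (2 * (𝔠.B₃ * θBal F.L γ 𝔠.b₀ p₁ (K - k)) * (((F.L : ℝ) ^ (k - b))⁻¹) ^ 2) ≤ 1 / 2 then
          (lieC (suGroupModel 2)).orthogonalProjectionOnto
            (vecE (suGroupModel 2).N
              (B27T (unitsField (toUField (Averaging.iter (fun i => BlockAveraging.blockAvg (P := F.P K) (j := i) ℰp) b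
                ((q K).UkH k (Hist.triv (F.P K) k) W)))) (anchors_nonempty (F := F) K b Y).choose c))
        else 0) := by
  intro K k hk j hj y hy W
  rw [hK K k hk j hj y hy W, zero_add, jet26_naturalChart_blockSet (birthChartRows q) N (by have := F.hm; omega) y]

end Record

end Summit.QuantumFields.YangMills.Theorems.GlobalSlackKernelLeg

end
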